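import Summits.Ventures.QEC.Census.Additive.CalibN05
import Literature.InformationTheory.QuantumCodes.ConcatenatedCodes
import HarnessLib

/-!
# Census rows by THEOREM ∘ KERNEL: `[[25, 1, 9]]` and `[[125, 1, 27]]` from the certified `[[5, 1, 3]]`

Venture QEC (cell `qec`), census table C (CRSS Table III comparison). HONEST FRAMING: these are EXISTENCE
lower bounds `AdditiveCodeExists n k d` (an `[[n, k, ≥ d]]` additive code exists), obtained with NO enumeration on
`25` or `125` qubits: the KERNEL-std certificate of the five-qubit code (`Census.Additive.additiveCodeExists_5_1_3_StabN5K1` of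
`Census/Additive/CalibN05.lean`, qec-search-5 data / qec-type-02 checker, tier KERNEL, `decide`, whitelist axioms) is fed to the PROVED concatenation theorem of Gottesman 1997 §3.5
(`Literature.InformationTheory.QuantumCodes.AdditiveCodeExists.concat`, p469910). CRSS Table III prints
`d = 9` at `(n, k) = (25, 1)` with lower-bound mark `d` = "[[25,1,9]] obtained by concatenating [[5,1,3]] with
itself (Fig. 1, Sec. 4)" (arXiv:quant-ph/9608006 PDF p.33, printed p.32; transcription
`run/shared/lean/pub/qec/lit/tables/CRSS1998-TableIII.tsv`), so the first row is a MATCH of the printed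
lower bound at tier THEOREM∘KERNEL-std; the upper bound `9` of that cell is the LP column (separate files,
`Census/LPBounds/`). Nothing here is a record or a distance EQUALITY for a specific code.
-/

namespace Summit.Ventures.QEC.Census

open Literature.InformationTheory.QuantumCodes

/-- **`[[25, 1, 9]]` exists** — the five-qubit code concatenated with itself (Gottesman 1997 §3.5, table 3.4;
CRSS 1998 Table III cell `(25, 1)`, mark `d`), by `AdditiveCodeExists.concat` applied to the KERNEL
`[[5, 1, 3]]` of `CalibN05.lean`. Tier THEOREM∘KERNEL-std. [cite: Gottesman1997, §3.5 (arXiv:quant-ph/9705052 chunk p0022 L93–100)] -/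
theorem additiveCodeExists_25_1_9 : AdditiveCodeExists 25 1 9 :=
  Additive.additiveCodeExists_5_1_3_StabN5K1.concat Additive.additiveCodeExists_5_1_3_StabN5K1 Nat.one_pos

/-- **`[[125, 1, 27]]` exists** — one more level of concatenation. Tier THEOREM∘KERNEL-std.
[cite: Gottesman1997, §3.5 (arXiv:quant-ph/9705052 chunk p0022 L93–100)] -/
theorem additiveCodeExists_125_1_27 : AdditiveCodeExists 125 1 27 :=
  additiveCodeExists_25_1_9.concat Additive.additiveCodeExists_5_1_3_StabN5K1 Nat.one_pos

end Summit.Ventures.QEC.Census
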